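import Summits.Parity.GeneralizedHardyLittlewood.Theorems.BeyondDiagonalBeatsQuarter.OffDiagPoissonApplied
import Summits.Parity.GeneralizedHardyLittlewood.Theorems.BeyondDiagonalBeatsQuarter.OffDiagPoissonTwistedSmooth
import Literature.Analysis.FunctionSpaces.BesselJLargeArgument
import HarnessLib

/-!
# Route `PrimeLevelFamEdge`, crux K_B (stmt-Parity-20343), line `diagonal_kernel_split` rev 4, plan Ω,
# worker key L3 (part 1) `OffDiagDualBoxSize`: the TRIVIAL size of one dual term — a uniform bound for the
# Fourier transform `Φ̂_i(ξ)` of a box weight, `|Φ̂_i(ξ)| ≤ (9/4)K₁K₂·sup_box|g|`, with the sup bound of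
# OMEGA-BLUEPRINT §2: `sup_box|g| ≤ (d₁d₂K₁K₂/4)^{−1/2}·W(X/4)·r⁻¹·J`, `J = 1` or `J = 35·(Z/2)^{−1/2}`

Objects (Ω-d5, `OffDiagPoissonApplied`): the real layer weight
`g(y) = layerWeightR q d₁ d₂ α β r y = ((d₁y₁)(d₂y₂))^{−1/2}·W((d₁y₁)(d₂y₂)/q̂²)·r⁻¹·J₁(4π√(αy₁βy₂)/(qr))` and the box
weight `Φ_i(y₁,y₂) = boxWeight q d₁ d₂ α β r i y₁ y₂ = θ(y₁/2^{i₁})θ(y₂/2^{i₂})·g(y)`, `K_j = 2^{i_j}`, supported in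
`[K₁/2,2K₁]×[K₂/2,2K₂]`. Scales (BLUEPRINT §2): `X = d₁d₂K₁K₂/q̂²`, `Z = 4π√(αβK₁K₂)/(qr)`. This file:
* §1 Bessel sizes: `|J₁(x)| ≤ 1` (tree) and `|J₁(x)| ≤ 35·x^{−1/2}` for `x > 0` (`abs_besselJ_one_le_rpow`, from the
  tree's Hankel estimate `abs_besselJ_sub_hankel_le` for `x ≥ 1` and `|J₁(x)| ≤ x/2` for `x ≤ 1`);
* §2 **`abs_layerWeightR_le`**: on the quadrant `y_j > K_j/2`, given any `J ≥ 0` with `|J₁(x)| ≤ J` for `x ≥ Z/2`: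
  `|g(y)| ≤ (d₁d₂K₁K₂/4)^{−1/2}·W(X/4)·r⁻¹·J` (`W` antitone, `(·)^{−1/2}` antitone);
  `norm_boxWeight_le` — the same bound for `‖Φ_i(t₁,t₂)‖` at EVERY point (`0 ≤ θθ ≤ 1`, `= 0` off the box);
* §3 **`norm_fourier2_boxWeight_le`**: `‖Φ̂_i(ξ₁,ξ₂)‖ ≤ (9/4)·K₁K₂·(d₁d₂K₁K₂/4)^{−1/2}·W(X/4)·r⁻¹·J` for all `ξ`
  (FI `norm_fourier2_le`: `|Φ̂| ≤ ∫∫|Φ|`, and the box has area `(3K₁/2)(3K₂/2)`); instances `…_le_one` (`J = 1`) and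
  `…_le_hankel` (`J = 35(Z/2)^{−1/2}`).
This is the «bulk(i,d,r)» of BLUEPRINT L3; the hyperbola count and the mollified total (`q^{κ₀η+o(1)}·Σms`) follow
in part 2 once L2's dual truncation is in. Absolute values only; nothing about the heart.
Helper (`--supports stmt-Parity-20343`); standard axioms.
«The programme SEARCHES and TYPES; no claim about Landau–Siegel zeros, Theorems 1–2 of arXiv:2211.02515 or
a repaired Margin232 until a kernel theorem says so.»
-/

noncomputable section

open Set MeasureTheory
open scoped Real

namespace Summit.Parity.GeneralizedHardyLittlewood.Theorems.BeyondDiagonalBeatsQuarter.OffDiag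

open Literature.NumberTheory.LFunctions Literature.NumberTheory.LFunctions.KMV2000
open Literature.Analysis.FunctionSpaces (besselJ abs_besselJ_one_le_one abs_besselJ_one_le_half_mul
  abs_besselJ_sub_hankel_le)
open Literature.Analysis.Calculus.WhitneyConvex (dyadicBump dyadicBump_nonneg dyadicBump_le_one)
open Literature.NumberTheory.Sieve.FriedlanderIwaniecPrimes (fourier2 BoxSupport norm_fourier2_le)

/-! ### §1. Sizes of `J₁` -/

/-- **`|J₁(x)| ≤ 35·x^{−1/2}` for `x > 0`** (for `x ≥ 1` from the tree's Hankel estimate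
`|J₁(x) − √(2/(πx))cos(x − 3π/4)| ≤ 34/x`, `√(2/π) ≤ 1`, `1/x ≤ x^{−1/2}`; for `x ≤ 1` from `|J₁(x)| ≤ x/2 ≤ x^{−1/2}`).
[cite: Iwaniec2002, Appendix B.4 (B.35) — derivation] -/
theorem abs_besselJ_one_le_rpow {x : ℝ} (hx : 0 < x) : |besselJ 1 x| ≤ 35 * x ^ (-(1 / 2 : ℝ)) := by
  have hxr : 0 < x ^ (-(1 / 2 : ℝ)) := Real.rpow_pos_of_pos hx _
  rcases le_or_gt x 1 with h1 | h1
  · -- small argument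
    have hs : x ≤ x ^ (-(1 / 2 : ℝ)) := by
      calc x = x ^ (1 : ℝ) := (Real.rpow_one x).symm
        _ ≤ x ^ (-(1 / 2 : ℝ)) := Real.rpow_le_rpow_of_exponent_ge hx h1 (by norm_num)
    calc |besselJ 1 x| ≤ x / 2 := abs_besselJ_one_le_half_mul hx.le
      _ ≤ 35 * x ^ (-(1 / 2 : ℝ)) := by linarith
  · -- large argument: Hankel
    have hH := abs_besselJ_sub_hankel_le 1 hx
    have hmain : |Real.sqrt (2 / (π * x)) * Real.cos (x - (1 : ℕ) * π / 2 - π / 4)| ≤ x ^ (-(1 / 2 : ℝ)) := by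
      rw [abs_mul]
      have hcos := Real.abs_cos_le_one (x - (1 : ℕ) * π / 2 - π / 4)
      have hsq : |Real.sqrt (2 / (π * x))| ≤ x ^ (-(1 / 2 : ℝ)) := by
        rw [abs_of_nonneg (Real.sqrt_nonneg _), Real.sqrt_eq_rpow, Real.rpow_neg hx.le,
          ← Real.inv_rpow hx.le]
        refine Real.rpow_le_rpow (by positivity) ?_ (by norm_num)
        rw [div_le_iff₀ (by positivity), inv_mul_eq_div, le_div_iff₀ hx]
        nlinarith [Real.pi_gt_three]
      calc |Real.sqrt (2 / (π * x))| * |Real.cos (x - (1 : ℕ) * π / 2 - π / 4)|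
          ≤ x ^ (-(1 / 2 : ℝ)) * 1 := mul_le_mul hsq hcos (abs_nonneg _) hxr.le
        _ = x ^ (-(1 / 2 : ℝ)) := mul_one _
    have herr : 17 * (1 + ((1 : ℕ) : ℝ) ^ 2) / x ≤ 34 * x ^ (-(1 / 2 : ℝ)) := by
      have h1x : 1 / x ≤ x ^ (-(1 / 2 : ℝ)) := by
        rw [one_div, ← Real.rpow_neg_one]
        exact Real.rpow_le_rpow_of_exponent_le h1.le (by norm_num)
      calc 17 * (1 + ((1 : ℕ) : ℝ) ^ 2) / x = 34 * (1 / x) := by norm_num; ring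
        _ ≤ 34 * x ^ (-(1 / 2 : ℝ)) := by gcongr
    have := abs_sub_abs_le_abs_sub (besselJ 1 x) (Real.sqrt (2 / (π * x)) * Real.cos (x - (1 : ℕ) * π / 2 - π / 4))
    linarith

/-! ### §2. The layer weight and the box weight on a box -/

section Sup

variable {q d₁ d₂ α β r : ℕ}

/-- **Sup of the layer weight on the quadrant `y_j > K_j/2`.** Let `q, d₁, d₂ ≥ 1`, `K₁, K₂ > 0`, `J` with
`|J₁(x)| ≤ J` for all `x ≥ Z/2`, `Z = 4π√(αβK₁K₂)/(qr)`. Then for `y₁ > K₁/2`, `y₂ > K₂/2`: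
`|g(y)| ≤ (d₁d₂K₁K₂/4)^{−1/2}·W(d₁d₂K₁K₂/(4q̂²))·r⁻¹·J`. [cite: KowalskiMichelVanderKam2000, (21)–(22) p. 12; KowalskiMichel2000, §2.4.2 p. 312 — derivation] -/
theorem abs_layerWeightR_le [NeZero q] (hd₁ : 1 ≤ d₁) (hd₂ : 1 ≤ d₂) {K₁ K₂ : ℝ} (hK₁ : 0 < K₁) (hK₂ : 0 < K₂)
    {J : ℝ}
    (hJ : ∀ x : ℝ, 4 * π * Real.sqrt ((α : ℝ) * (β : ℝ) * (K₁ * K₂)) / ((q : ℝ) * r) / 2 ≤ x → |besselJ 1 x| ≤ J)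
    {y : ℝ × ℝ} (hy₁ : K₁ / 2 < y.1) (hy₂ : K₂ / 2 < y.2) :
    |layerWeightR q d₁ d₂ α β r y| ≤
      ((d₁ : ℝ) * d₂ * (K₁ * K₂) / 4) ^ (-(1 / 2 : ℝ)) * cutoffW ((d₁ : ℝ) * d₂ * (K₁ * K₂) / 4 / qhat q ^ 2) *
        (r : ℝ)⁻¹ * J := by
  have hQ : 0 < qhat q := qhat_pos_of_neZero q
  have hd₁0 : (0 : ℝ) < d₁ := by exact_mod_cast hd₁
  have hd₂0 : (0 : ℝ) < d₂ := by exact_mod_cast hd₂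
  have hy1 : 0 < y.1 := lt_trans (by positivity) hy₁
  have hy2 : 0 < y.2 := lt_trans (by positivity) hy₂
  -- the product `P = d₁y₁·d₂y₂ ≥ d₁d₂K₁K₂/4`
  set P : ℝ := (d₁ : ℝ) * y.1 * ((d₂ : ℝ) * y.2) with hP
  have hP0 : 0 < P := by positivity
  have hB0 : 0 < (d₁ : ℝ) * d₂ * (K₁ * K₂) / 4 := by positivity
  have hPB : (d₁ : ℝ) * d₂ * (K₁ * K₂) / 4 ≤ P := by
    have h12 : K₁ / 2 * (K₂ / 2) ≤ y.1 * y.2 := mul_le_mul hy₁.le hy₂.le (by positivity) hy1.le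
    calc (d₁ : ℝ) * d₂ * (K₁ * K₂) / 4 = (d₁ : ℝ) * d₂ * (K₁ / 2 * (K₂ / 2)) := by ring
      _ ≤ (d₁ : ℝ) * d₂ * (y.1 * y.2) := mul_le_mul_of_nonneg_left h12 (by positivity)
      _ = P := by rw [hP]; ring
  -- the three factors
  have h1 : P ^ (-(1 / 2 : ℝ)) ≤ ((d₁ : ℝ) * d₂ * (K₁ * K₂) / 4) ^ (-(1 / 2 : ℝ)) :=
    Real.rpow_le_rpow_of_nonpos hB0 hPB (by norm_num)
  have h2 : cutoffW (P / qhat q ^ 2) ≤ cutoffW ((d₁ : ℝ) * d₂ * (K₁ * K₂) / 4 / qhat q ^ 2) :=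
    cutoffW_antitoneOn (show (0 : ℝ) ≤ _ by positivity) (show (0 : ℝ) ≤ P / qhat q ^ 2 by positivity)
      (div_le_div_of_nonneg_right hPB (by positivity))
  have h3 : |besselJ 1 (4 * π * Real.sqrt ((α : ℝ) * y.1 * ((β : ℝ) * y.2)) / ((q : ℝ) * r))| ≤ J := by
    refine hJ _ ?_
    have hs : Real.sqrt ((α : ℝ) * (β : ℝ) * (K₁ * K₂)) / 2 ≤ Real.sqrt ((α : ℝ) * y.1 * ((β : ℝ) * y.2)) := by
      have h4 : Real.sqrt 4 = 2 := by
        rw [show (4 : ℝ) = 2 ^ 2 by norm_num, Real.sqrt_sq (by norm_num)]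
      rw [← h4, ← Real.sqrt_div (by positivity)]
      refine Real.sqrt_le_sqrt ?_
      rw [div_le_iff₀ (by norm_num)]
      have h12 : K₁ * K₂ ≤ y.1 * y.2 * 4 := by nlinarith
      calc (α : ℝ) * β * (K₁ * K₂) ≤ (α : ℝ) * β * (y.1 * y.2 * 4) :=
            mul_le_mul_of_nonneg_left h12 (by positivity)
        _ = (α : ℝ) * y.1 * ((β : ℝ) * y.2) * 4 := by ring
    calc 4 * π * Real.sqrt ((α : ℝ) * (β : ℝ) * (K₁ * K₂)) / ((q : ℝ) * r) / 2
        = 4 * π * (Real.sqrt ((α : ℝ) * (β : ℝ) * (K₁ * K₂)) / 2) / ((q : ℝ) * r) := by ring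
      _ ≤ 4 * π * Real.sqrt ((α : ℝ) * y.1 * ((β : ℝ) * y.2)) / ((q : ℝ) * r) := by
          gcongr
  have hWP : 0 ≤ cutoffW (P / qhat q ^ 2) := cutoffW_nonneg _
  have hWB : 0 ≤ cutoffW ((d₁ : ℝ) * d₂ * (K₁ * K₂) / 4 / qhat q ^ 2) := cutoffW_nonneg _
  have hr0 : (0 : ℝ) ≤ (r : ℝ)⁻¹ := by positivity
  unfold layerWeightR
  rw [← hP, abs_mul, abs_mul, abs_mul, abs_of_nonneg (Real.rpow_nonneg hP0.le _),
    abs_of_nonneg hWP, abs_of_nonneg hr0]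
  exact mul_le_mul (mul_le_mul_of_nonneg_right (mul_le_mul h1 h2 hWP (by positivity)) hr0) h3
    (abs_nonneg _) (by positivity)

/-- The support box of `Φ_i`: if `θ(t₁/2^{i₁})θ(t₂/2^{i₂}) ≠ 0` then `2^{i_j}/2 < t_j < 2·2^{i_j}`. [folklore] -/
theorem mem_box_of_bump₂_ne_zero {i : ℕ × ℕ} {t₁ t₂ : ℝ}
    (h : dyadicBump (t₁ / 2 ^ i.1) * dyadicBump (t₂ / 2 ^ i.2) ≠ 0) :
    ((2 : ℝ) ^ i.1 / 2 < t₁ ∧ t₁ < 2 * 2 ^ i.1) ∧ ((2 : ℝ) ^ i.2 / 2 < t₂ ∧ t₂ < 2 * 2 ^ i.2) :=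
  mem_box_of_dyadicBump₂_ne_zero (y := (t₁, t₂)) (by positivity) (by positivity) h

/-- **The box weight at every point**: under the hypotheses of `abs_layerWeightR_le` with `K_j = 2^{i_j}`,
`‖Φ_i(t₁,t₂)‖ ≤ (d₁d₂K₁K₂/4)^{−1/2}·W(d₁d₂K₁K₂/(4q̂²))·r⁻¹·J` for ALL `t` (`0 ≤ θθ ≤ 1`; `Φ_i = 0` off the box).
[cite: KowalskiMichelVanderKam2000, (21)–(22) p. 12 — derivation] -/
theorem norm_boxWeight_le [NeZero q] (hd₁ : 1 ≤ d₁) (hd₂ : 1 ≤ d₂) (i : ℕ × ℕ) {J : ℝ} (hJ0 : 0 ≤ J)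
    (hJ : ∀ x : ℝ, 4 * π * Real.sqrt ((α : ℝ) * (β : ℝ) * ((2 : ℝ) ^ i.1 * 2 ^ i.2)) / ((q : ℝ) * r) / 2 ≤ x →
      |besselJ 1 x| ≤ J) (t₁ t₂ : ℝ) :
    ‖boxWeight q d₁ d₂ α β r i t₁ t₂‖ ≤
      ((d₁ : ℝ) * d₂ * ((2 : ℝ) ^ i.1 * 2 ^ i.2) / 4) ^ (-(1 / 2 : ℝ)) *
        cutoffW ((d₁ : ℝ) * d₂ * ((2 : ℝ) ^ i.1 * 2 ^ i.2) / 4 / qhat q ^ 2) * (r : ℝ)⁻¹ * J := by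
  have hS0 : 0 ≤ ((d₁ : ℝ) * d₂ * ((2 : ℝ) ^ i.1 * 2 ^ i.2) / 4) ^ (-(1 / 2 : ℝ)) *
      cutoffW ((d₁ : ℝ) * d₂ * ((2 : ℝ) ^ i.1 * 2 ^ i.2) / 4 / qhat q ^ 2) * (r : ℝ)⁻¹ * J := by
    have := cutoffW_nonneg ((d₁ : ℝ) * d₂ * ((2 : ℝ) ^ i.1 * 2 ^ i.2) / 4 / qhat q ^ 2)
    positivity
  by_cases hθ : dyadicBump (t₁ / 2 ^ i.1) * dyadicBump (t₂ / 2 ^ i.2) = 0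
  · rw [boxWeight, hθ, Complex.ofReal_zero, zero_mul, norm_zero]; exact hS0
  obtain ⟨⟨h1, -⟩, ⟨h2, -⟩⟩ := mem_box_of_bump₂_ne_zero hθ
  have hθle : dyadicBump (t₁ / 2 ^ i.1) * dyadicBump (t₂ / 2 ^ i.2) ≤ 1 :=
    mul_le_one₀ (dyadicBump_le_one _) (dyadicBump_nonneg _) (dyadicBump_le_one _)
  have hθnn : 0 ≤ dyadicBump (t₁ / 2 ^ i.1) * dyadicBump (t₂ / 2 ^ i.2) :=
    mul_nonneg (dyadicBump_nonneg _) (dyadicBump_nonneg _)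
  have hg := abs_layerWeightR_le (q := q) (α := α) (β := β) (r := r) hd₁ hd₂
    (by positivity : (0 : ℝ) < 2 ^ i.1) (by positivity : (0 : ℝ) < 2 ^ i.2) hJ (y := (t₁, t₂)) h1 h2
  rw [boxWeight, norm_mul, Complex.norm_real, Complex.norm_real, Real.norm_of_nonneg hθnn, Real.norm_eq_abs]
  calc dyadicBump (t₁ / 2 ^ i.1) * dyadicBump (t₂ / 2 ^ i.2) * |layerWeightR q d₁ d₂ α β r (t₁, t₂)|
      ≤ 1 * (((d₁ : ℝ) * d₂ * ((2 : ℝ) ^ i.1 * 2 ^ i.2) / 4) ^ (-(1 / 2 : ℝ)) *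
          cutoffW ((d₁ : ℝ) * d₂ * ((2 : ℝ) ^ i.1 * 2 ^ i.2) / 4 / qhat q ^ 2) * (r : ℝ)⁻¹ * J) :=
        mul_le_mul hθle hg (abs_nonneg _) zero_le_one
    _ = _ := one_mul _

/-- The box weight vanishes off the box `[2^{i₁}/2, 2·2^{i₁}] × [2^{i₂}/2, 2·2^{i₂}]`. [folklore] -/
theorem boxWeight_eq_zero_of_not_mem {i : ℕ × ℕ} {t₁ t₂ : ℝ}
    (h : ¬ (t₁ ∈ Icc ((2 : ℝ) ^ i.1 / 2) (2 * 2 ^ i.1) ∧ t₂ ∈ Icc ((2 : ℝ) ^ i.2 / 2) (2 * 2 ^ i.2))) :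
    boxWeight q d₁ d₂ α β r i t₁ t₂ = 0 := by
  by_contra hne
  have hθ : dyadicBump (t₁ / 2 ^ i.1) * dyadicBump (t₂ / 2 ^ i.2) ≠ 0 := by
    intro h0; exact hne (by rw [boxWeight, h0, Complex.ofReal_zero, zero_mul])
  obtain ⟨⟨a1, a2⟩, ⟨b1, b2⟩⟩ := mem_box_of_bump₂_ne_zero hθ
  exact h ⟨⟨a1.le, a2.le⟩, ⟨b1.le, b2.le⟩⟩

/-- Box support of `Φ_i` in the FI sense (`|t_j| ≤ 2(2^{i₁} + 2^{i₂})`). [folklore] -/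
theorem boxSupport_boxWeight (i : ℕ × ℕ) :
    BoxSupport (boxWeight q d₁ d₂ α β r i) (2 * ((2 : ℝ) ^ i.1 + 2 ^ i.2)) := by
  intro t₁ t₂ hne
  have hθ : dyadicBump (t₁ / 2 ^ i.1) * dyadicBump (t₂ / 2 ^ i.2) ≠ 0 := by
    intro h0; exact hne (by rw [boxWeight, h0, Complex.ofReal_zero, zero_mul])
  obtain ⟨⟨a1, a2⟩, ⟨b1, b2⟩⟩ := mem_box_of_bump₂_ne_zero hθ
  have h1 : (0 : ℝ) < 2 ^ i.1 := by positivity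
  have h2 : (0 : ℝ) < 2 ^ i.2 := by positivity
  constructor
  · rw [abs_le]; constructor <;> linarith
  · rw [abs_le]; constructor <;> linarith

end Sup

/-! ### §3. The Fourier transform of a box weight is bounded by the bulk -/

section Bulk

variable {q d₁ d₂ α β r : ℕ}

/-- **`∫∫|Φ_i| ≤ (9/4)K₁K₂·S`** whenever `‖Φ_i‖ ≤ S` pointwise (`S ≥ 0`): `Φ_i` lives in a box of area `(3K₁/2)(3K₂/2)`.
[folklore] -/
theorem integral_integral_norm_boxWeight_le (i : ℕ × ℕ) {S : ℝ} (hS0 : 0 ≤ S)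
    (hS : ∀ t₁ t₂ : ℝ, ‖boxWeight q d₁ d₂ α β r i t₁ t₂‖ ≤ S) :
    (∫ t₁, ∫ t₂, ‖boxWeight q d₁ d₂ α β r i t₁ t₂‖) ≤ 9 / 4 * ((2 : ℝ) ^ i.1 * 2 ^ i.2) * S := by
  set K₁ : ℝ := (2 : ℝ) ^ i.1 with hK₁
  set K₂ : ℝ := (2 : ℝ) ^ i.2 with hK₂
  have hK₁0 : 0 < K₁ := by positivity
  have hK₂0 : 0 < K₂ := by positivity
  set I₁ : Set ℝ := Icc (K₁ / 2) (2 * K₁) with hI₁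
  set I₂ : Set ℝ := Icc (K₂ / 2) (2 * K₂) with hI₂
  have hm₁ : MeasurableSet I₁ := measurableSet_Icc
  have hm₂ : MeasurableSet I₂ := measurableSet_Icc
  have hv₁ : volume.real I₁ = 3 / 2 * K₁ := by rw [hI₁, Real.volume_real_Icc_of_le (by linarith)]; ring
  have hv₂ : volume.real I₂ = 3 / 2 * K₂ := by rw [hI₂, Real.volume_real_Icc_of_le (by linarith)]; ring
  -- pointwise: `‖Φ‖ ≤ S·𝟙_{I₁}(t₁)·𝟙_{I₂}(t₂)`
  have hpt : ∀ t₁ t₂ : ℝ, ‖boxWeight q d₁ d₂ α β r i t₁ t₂‖ ≤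
      I₁.indicator (fun _ ↦ S) t₁ * I₂.indicator (fun _ ↦ (1 : ℝ)) t₂ := by
    intro t₁ t₂
    by_cases h : t₁ ∈ I₁ ∧ t₂ ∈ I₂
    · rw [indicator_of_mem h.1, indicator_of_mem h.2, mul_one]; exact hS t₁ t₂
    · rw [boxWeight_eq_zero_of_not_mem h, norm_zero]
      exact mul_nonneg (indicator_nonneg (fun _ _ ↦ hS0) _) (indicator_nonneg (fun _ _ ↦ zero_le_one) _)
  -- inner integral
  have hinner : ∀ t₁ : ℝ, (∫ t₂, ‖boxWeight q d₁ d₂ α β r i t₁ t₂‖) ≤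
      I₁.indicator (fun _ ↦ S) t₁ * (3 / 2 * K₂) := by
    intro t₁
    have hint : Integrable (fun t₂ : ℝ ↦ I₁.indicator (fun _ ↦ S) t₁ * I₂.indicator (fun _ ↦ (1 : ℝ)) t₂) :=
      ((integrable_indicator_iff hm₂).2 (integrableOn_const (by
        rw [hI₂]; exact measure_Icc_lt_top.ne))).const_mul _
    calc (∫ t₂, ‖boxWeight q d₁ d₂ α β r i t₁ t₂‖)
        ≤ ∫ t₂, I₁.indicator (fun _ ↦ S) t₁ * I₂.indicator (fun _ ↦ (1 : ℝ)) t₂ :=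
          integral_mono_of_nonneg (Filter.Eventually.of_forall fun _ ↦ norm_nonneg _) hint
            (Filter.Eventually.of_forall fun t₂ ↦ hpt t₁ t₂)
      _ = I₁.indicator (fun _ ↦ S) t₁ * (3 / 2 * K₂) := by
          rw [integral_const_mul, integral_indicator_const _ hm₂, hv₂, smul_eq_mul, mul_one]
  -- outer integral
  have hint₁ : Integrable (fun t₁ : ℝ ↦ I₁.indicator (fun _ ↦ S) t₁ * (3 / 2 * K₂)) :=
    ((integrable_indicator_iff hm₁).2 (integrableOn_const (by
      rw [hI₁]; exact measure_Icc_lt_top.ne))).mul_const _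
  calc (∫ t₁, ∫ t₂, ‖boxWeight q d₁ d₂ α β r i t₁ t₂‖)
      ≤ ∫ t₁, I₁.indicator (fun _ ↦ S) t₁ * (3 / 2 * K₂) :=
        integral_mono_of_nonneg (Filter.Eventually.of_forall fun _ ↦ integral_nonneg fun _ ↦ norm_nonneg _)
          hint₁ (Filter.Eventually.of_forall hinner)
    _ = S * (3 / 2 * K₁) * (3 / 2 * K₂) := by
        rw [integral_mul_const, integral_indicator_const _ hm₁, hv₁, smul_eq_mul]; ring
    _ = 9 / 4 * (K₁ * K₂) * S := by ring

/-- **L3 bulk: `|Φ̂_i(ξ₁,ξ₂)| ≤ (9/4)·K₁K₂·(d₁d₂K₁K₂/4)^{−1/2}·W(d₁d₂K₁K₂/(4q̂²))·r⁻¹·J`** for all `ξ`, whenever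
`|J₁(x)| ≤ J` (`J ≥ 0`) for `x ≥ Z/2`, `Z = 4π√(αβK₁K₂)/(qr)`; `q, d₁, d₂, α, β ≥ 1`, `K_j = 2^{i_j}`.
[cite: KowalskiMichelVanderKam2000, (21)–(23) p. 12 and Lemma 3.3 p. 9 — derivation] -/
theorem norm_fourier2_boxWeight_le [NeZero q] (hd₁ : 1 ≤ d₁) (hd₂ : 1 ≤ d₂) (hα : 1 ≤ α) (hβ : 1 ≤ β)
    (i : ℕ × ℕ) {J : ℝ} (hJ0 : 0 ≤ J)
    (hJ : ∀ x : ℝ, 4 * π * Real.sqrt ((α : ℝ) * (β : ℝ) * ((2 : ℝ) ^ i.1 * 2 ^ i.2)) / ((q : ℝ) * r) / 2 ≤ x →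
      |besselJ 1 x| ≤ J) (ξ₁ ξ₂ : ℝ) :
    ‖fourier2 (boxWeight q d₁ d₂ α β r i) ξ₁ ξ₂‖ ≤
      9 / 4 * ((2 : ℝ) ^ i.1 * 2 ^ i.2) *
        (((d₁ : ℝ) * d₂ * ((2 : ℝ) ^ i.1 * 2 ^ i.2) / 4) ^ (-(1 / 2 : ℝ)) *
          cutoffW ((d₁ : ℝ) * d₂ * ((2 : ℝ) ^ i.1 * 2 ^ i.2) / 4 / qhat q ^ 2) * (r : ℝ)⁻¹ * J) := by
  have hS0 : 0 ≤ ((d₁ : ℝ) * d₂ * ((2 : ℝ) ^ i.1 * 2 ^ i.2) / 4) ^ (-(1 / 2 : ℝ)) *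
      cutoffW ((d₁ : ℝ) * d₂ * ((2 : ℝ) ^ i.1 * 2 ^ i.2) / 4 / qhat q ^ 2) * (r : ℝ)⁻¹ * J := by
    have := cutoffW_nonneg ((d₁ : ℝ) * d₂ * ((2 : ℝ) ^ i.1 * 2 ^ i.2) / 4 / qhat q ^ 2)
    positivity
  have hc : Continuous (Function.uncurry (boxWeight q d₁ d₂ α β r i)) :=
    (contDiff_uncurry_boxWeight hd₁ hd₂ hα hβ i).continuous
  exact (norm_fourier2_le (boxSupport_boxWeight i) hc ξ₁ ξ₂).trans
    (integral_integral_norm_boxWeight_le i hS0 (norm_boxWeight_le hd₁ hd₂ i hJ0 hJ))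

/-- **Bulk with `J = 1`** (`|J₁| ≤ 1`). [cite: KowalskiMichelVanderKam2000, (21)–(23) p. 12 — derivation] -/
theorem norm_fourier2_boxWeight_le_one [NeZero q] (hd₁ : 1 ≤ d₁) (hd₂ : 1 ≤ d₂) (hα : 1 ≤ α) (hβ : 1 ≤ β)
    (i : ℕ × ℕ) (ξ₁ ξ₂ : ℝ) :
    ‖fourier2 (boxWeight q d₁ d₂ α β r i) ξ₁ ξ₂‖ ≤
      9 / 4 * ((2 : ℝ) ^ i.1 * 2 ^ i.2) *
        (((d₁ : ℝ) * d₂ * ((2 : ℝ) ^ i.1 * 2 ^ i.2) / 4) ^ (-(1 / 2 : ℝ)) *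
          cutoffW ((d₁ : ℝ) * d₂ * ((2 : ℝ) ^ i.1 * 2 ^ i.2) / 4 / qhat q ^ 2) * (r : ℝ)⁻¹ * 1) :=
  norm_fourier2_boxWeight_le hd₁ hd₂ hα hβ i zero_le_one (fun x _ ↦ abs_besselJ_one_le_one x) ξ₁ ξ₂

/-- **Bulk with the Hankel size `J = 35·(Z/2)^{−1/2}`** (`r ≥ 1`; `|J₁(x)| ≤ 35x^{−1/2} ≤ 35(Z/2)^{−1/2}` for `x ≥ Z/2`).
[cite: Iwaniec2002, Appendix B.4 (B.35); KowalskiMichelVanderKam2000, (21)–(23) p. 12 — derivation] -/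
theorem norm_fourier2_boxWeight_le_hankel [NeZero q] (hd₁ : 1 ≤ d₁) (hd₂ : 1 ≤ d₂) (hα : 1 ≤ α) (hβ : 1 ≤ β)
    (hr : 1 ≤ r) (i : ℕ × ℕ) (ξ₁ ξ₂ : ℝ) :
    ‖fourier2 (boxWeight q d₁ d₂ α β r i) ξ₁ ξ₂‖ ≤
      9 / 4 * ((2 : ℝ) ^ i.1 * 2 ^ i.2) *
        (((d₁ : ℝ) * d₂ * ((2 : ℝ) ^ i.1 * 2 ^ i.2) / 4) ^ (-(1 / 2 : ℝ)) *
          cutoffW ((d₁ : ℝ) * d₂ * ((2 : ℝ) ^ i.1 * 2 ^ i.2) / 4 / qhat q ^ 2) * (r : ℝ)⁻¹ *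
          (35 * (4 * π * Real.sqrt ((α : ℝ) * (β : ℝ) * ((2 : ℝ) ^ i.1 * 2 ^ i.2)) / ((q : ℝ) * r) / 2) ^
            (-(1 / 2 : ℝ)))) := by
  have hq0 : (0 : ℝ) < q := by exact_mod_cast Nat.pos_of_ne_zero (NeZero.ne q)
  have hr0 : (0 : ℝ) < r := by exact_mod_cast hr
  have hα0 : (0 : ℝ) < α := by exact_mod_cast hα
  have hβ0 : (0 : ℝ) < β := by exact_mod_cast hβ
  have hZ : 0 < 4 * π * Real.sqrt ((α : ℝ) * (β : ℝ) * ((2 : ℝ) ^ i.1 * 2 ^ i.2)) / ((q : ℝ) * r) / 2 := by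
    have : 0 < Real.sqrt ((α : ℝ) * (β : ℝ) * ((2 : ℝ) ^ i.1 * 2 ^ i.2)) := Real.sqrt_pos.2 (by positivity)
    positivity
  refine norm_fourier2_boxWeight_le hd₁ hd₂ hα hβ i (by positivity) (fun x hx ↦ ?_) ξ₁ ξ₂
  have hx0 : 0 < x := lt_of_lt_of_le hZ hx
  calc |besselJ 1 x| ≤ 35 * x ^ (-(1 / 2 : ℝ)) := abs_besselJ_one_le_rpow hx0
    _ ≤ 35 * (4 * π * Real.sqrt ((α : ℝ) * (β : ℝ) * ((2 : ℝ) ^ i.1 * 2 ^ i.2)) / ((q : ℝ) * r) / 2) ^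
          (-(1 / 2 : ℝ)) :=
        mul_le_mul_of_nonneg_left (Real.rpow_le_rpow_of_nonpos hZ hx (by norm_num)) (by norm_num)

end Bulk

end Summit.Parity.GeneralizedHardyLittlewood.Theorems.BeyondDiagonalBeatsQuarter.OffDiag
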